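import Summits.BirchSwinnertonDyer.BirchSwinnertonDyer.Theorems.ClassRecordThreeEulerHalvesAtThreeHybridInertShape
import Summits.BirchSwinnertonDyer.BirchSwinnertonDyer.Theorems.ClassRecordThreeEulerHalvesAtThreePoitouTateOfCanonical
import Summits.BirchSwinnertonDyer.BirchSwinnertonDyer.Theorems.ClassRecordThreeEulerHalvesAtThreeTwistLowerOfX11a
import Summits.BirchSwinnertonDyer.BirchSwinnertonDyer.Theorems.ClassRecordThreeKolyvaginShaOrderDivisibleEnd
import Summits.BirchSwinnertonDyer.BirchSwinnertonDyer.Theorems.ClassRecordThreeEulerHalvesAtThreeInertDisplayOfPrimitives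
import Summits.BirchSwinnertonDyer.BirchSwinnertonDyer.Theorems.ClassRecordThreeEulerHalvesAtThreeNotRamInertServableCutNormalForm
import Summits.BirchSwinnertonDyer.BirchSwinnertonDyer.Theorems.ClassRecordThreeEulerHalvesAtThreeShimuraInertSavingDisplayOfE0Prime
import Summits.BirchSwinnertonDyer.BirchSwinnertonDyer.Theorems.ClassRecordThreeEulerHalvesAtThreeShimuraAuxNormE0Prime
import Summits.BirchSwinnertonDyer.BirchSwinnertonDyer.Theorems.ClassRecordThreeEulerHalvesAtThreeAuxInertLevelOfChebotarev
import Summits.BirchSwinnertonDyer.BirchSwinnertonDyer.Theorems.ClassRecordThreeEulerHalvesAtThreeAuxInertLevelAtThree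
import Summits.BirchSwinnertonDyer.BirchSwinnertonDyer.Theorems.ClassRecordThreeEulerHalvesAtThreeCarrierLocalE0AtThree
import Summits.BirchSwinnertonDyer.BirchSwinnertonDyer.Theorems.ClassRecordThreeCornerAtThreeMilneTamagawaHolds
import Summits.BirchSwinnertonDyer.BirchSwinnertonDyer.Theorems.SchneiderFreeAdditiveX3PoitouTateReciprocitySumHolds
import Summits.BirchSwinnertonDyer.BirchSwinnertonDyer.Theorems.SemiOrdinaryEisensteinDescentShaTwoCochainShell
import Summits.BirchSwinnertonDyer.BirchSwinnertonDyer.Theorems.SemiOrdinaryEisensteinDescentShaTwoCochainBridgeAssemblyCriterion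
import Summits.BirchSwinnertonDyer.BirchSwinnertonDyer.Theorems.SemiOrdinaryEisensteinDescentShaTwoCochainClassReadout
import Literature.NumberTheory.EllipticCurves.HeegnerPointsIdentityComponentProofs
import HarnessLib

/-!
# Route `ClassRecordThree` (rung K2@3), crux 5 `EulerHalvesAtThree` (item stmt-BirchSwinnertonDyer-19109, shared by
# `KolyvaginRoadThree`): the r21 ITEMS-CLOSER of line `inert` — the crux BY NAME from FIVE EXISTING ROUTE ITEMS and exactly
# THREE raw inputs (cell `bsd-stepL`, seat `bsd-stepL-tam3-p1` g19, line owner; `--supports stmt-BirchSwinnertonDyer-19109`)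

HONEST FRAMING: theorems only (no definition, no named fact, no `sorry`); CONDITIONAL on route items taken BY NAME and on three
inputs displayed RAW (hypothesis shape, nothing asserted); item 19109 does NOT close by this file; nothing is asserted about any curve;
BSD is proved for no curve; no census word, tier or label moves (T7).

WHAT. `eulerHalvesAtThree_of_items_r21` (+ the `KolyvaginRoadThree` twin) proves
`Summit.BirchSwinnertonDyer.BirchSwinnertonDyer.Theses.ClassRecordThree.EulerHalvesAtThree` from
* route items BY NAME: `PublishedInputsThree` (19112), `EulerHalfGrossPrintFacts` (27981; Gross 1991 Prop. 3.7 (2) + §6 ∕ [GZ86 III (3.1)]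
  image-free — hF1 via `Gross1991_heegnerPoint_sub_ratTorsion_mem_E0_of_imageFree`), `ShimuraParametrizationDataNonempty` (19524), and route
  `ErratumRoadFive`'s `PastenComponentOrdersInput` (19716) and crux `X11aLowerHalf` (19064, READ AT `p = 3`: `fun V _ _ h ↦ hX V 3 h`);
* KERNEL THEOREMS: the Cassels–Tate level inputs (the proof term of `ShaTwoCochainTheta.casselsTate_levelInputs_of_shaTwoCochainBridge`, item 20191 CLOSED,
  cell bsd-wall, over its three route-independent modules — the closer module itself imports four Theses files), Poitou–Tate for Selmer structures (`…selmerComplement_canonical_holds`, bsd-schneider), Milne I.3.8 (`MilneTamagawa.…_holds`,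
  corner3-p2), and this line's three proved stubs `CarrierLocalE0.stub_carrierLocalE0AtThree` (p645044), `AuxInertLevel.stub_auxiliaryInertLevelAtThree`
  (p654833 ∘ `ChebSupply.stub_chebotarevSupplyAtThree` p654253) through the E′-supplier `e0PrimeSupplyAtThree` below;
* THREE RAW inputs: `hPT2` (Poitou–Tate duality `Ш¹(K,M^D) × Ш²(K,M)`, `poitouTate_sha_tateDual`, cite-only, no CR3 ∕ KR3 item), `hPrim` (the CM-point
  primitives of `X_{N⁺,N⁻}` at the inert `3`, `shimuraCurve_heegnerSystem_primitivesAtThreeInert`, cite-only, no item) and `hRes` — the IMC-grade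
  residue: the Kolyvagin-system («⊇») half at `𝟙` on the surj X11b@3 frames of the curves in the residual Tamagawa shapes (two additive IV ∕ IV*
  `3`-carriers, or one beside an even number of split multiplicative carriers), BEYOND PRINT at `p = 3 ∥ N` (Howard 2004 Thm. B needs `p ∤ 6N`;
  BCGS Thm. 2 good ordinary `p > 3`; barrier `StringentKolyvaginCapsAtMax` for every Kolyvagin-type refinement).
Versus g17's `eulerHalvesAtThree_of_items` (p638185, r16): `hB6` (PrimitivesWithB6TD, beyond print) is GONE (r17: E′-label road), `hF1`∕`h372` are
item 27981, `hCT` is a theorem, `hCO`∕`hX11a` are items of `ErratumRoadFive` by name. The `H21.Audit` `proof.conditional` list of the closer is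
therefore {five items, hPT2, hPrim, hRes}: what CR3 ∕ KR3 must file (two cite-only asides, one IMC-grade item — named `Theorems.EulerHalvesAtThreeCoStepLResidual`
in the companion Defs proposal — and by-name aliases of 19716 ∕ 19064) for 19109 to close modulo route items (RULING 65 (c) pattern).

References: [GrossLMS1991] Prop. 3.7 (2), §6; [GrossZagier1986] III (3.1); [McCallumLMS1991] Cor. 5.6; [Jetchev2008] Thm. 1.4, Cor. 1.5;
[PastenShimura2024] §6, Prop. 5.1; [CaiShuTian2014] Thm. 1.5; [MilneADT2006] I Thm. 4.10, Prop. 3.8, §6; [Harari2020] Thm. 17.13 (b);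
[Skinner2016PacificMC] Thm. C; [Castella2018] Thm. 3.2 (shape); tree `Cruxes/EulerHalvesAtThree/Lines/inert.lean` (r20 registered, r21 candidate).
-/

set_option linter.dupNamespace false
set_option autoImplicit false

noncomputable section

open scoped Classical NumberField Pointwise

namespace Summit.BirchSwinnertonDyer.BirchSwinnertonDyer.Theorems.EulerHalvesInertR21

open WeierstrassCurve IsDedekindDomain NumberField Field Literature.NumberTheory.EllipticCurves
  Literature.NumberTheory.EllipticCurves.ModularForms Literature.NumberTheory.EllipticCurves.Jetchev2008
  Literature.NumberTheory.EllipticCurves.KolyvaginCocycle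
  Literature.NumberTheory.EllipticCurves.Rank1Residual Literature.NumberTheory.GaloisRepresentations
  Literature.NumberTheory.GaloisRepresentations.DiscreteGaloisModule
  Literature.NumberTheory.GaloisCohomology Literature.NumberTheory.Automorphic
  Literature.NumberTheory.EllipticCurves.BarriosEtAl2025 CongruenceSubgroup
  Summit.BirchSwinnertonDyer.Rank1Residual Summit.BirchSwinnertonDyer.Rank1Residual.X11b
  Summit.BirchSwinnertonDyer.Rank1Residual.X11b.Three Summit.BirchSwinnertonDyer.Rank1Residual.X11b.Three.Koly
  Summit.BirchSwinnertonDyer.Rank1Residual.JET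
  Literature.NumberTheory.EllipticCurves.Rank1Residual.Typed Literature.NumberTheory.QuadraticFields.Quadratic
  Summit.BirchSwinnertonDyer.Rank1Residual.X11b.AcSelmer
  Summit.BirchSwinnertonDyer.BirchSwinnertonDyer.Theorems

/-- **The E′-supplier of line `inert` (r17–r21 `hE0sup_of_stubs`), a THEOREM**: on a surj frame with `d_K < −4` and every bad prime outside
`S` split in `K`, at every `K`-split `3`-carrier `q ∉ S` some prime-to-`3` multiple `n' • y_m` of every labelled Heegner point of conductor
`m` (square-free, prime to `N`, inert primes) has NON-SINGULAR reduction at every place `w ∣ q` of `K[m]` — by bsd-idea-9's auxiliary-norm road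
`ShimuraWalk.carrierLabelsE0Prime_of_galTrivial_of_kills_of_auxLevel` (er5-w3 ∕ tam3-p1 g18 p641143) fed by the PROVED stubs
`CarrierLocalE0.stub_carrierLocalE0AtThree` (p645044: Galois-trivial `Φ_w` of order `3` killed by the local norm) and
`AuxInertLevel.stub_auxiliaryInertLevelAtThree` (p654833: an auxiliary inert level `ℓ₀` whose ring-class Galois group has `3^e ∣ #Stab(w)`).
[cite: GrossLMS1991, §6 p. 245] [cite: GrossZagier1986, III (3.1)] -/
theorem e0PrimeSupplyAtThree :
    ∀ (W : WeierstrassCurve ℚ) [W.IsElliptic] [W.IsGloballyMinimal] (N : ℕ) [NeZero N]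
      (K : Type) [Field K] [NumberField K] (S : Finset ℕ),
      Surj W 3 → ∀ (hK : IsImaginaryQuadratic K), NumberField.discr K < -4 →
      (∀ ℓ : ℕ, ℓ.Prime → ℓ ∣ N → ℓ ∉ S → ((Ideal.span {(ℓ : ℤ)}).primesOver (𝓞 K)).ncard = 2) →
      ∀ (ι : K →+* ℂ) (y : (W.baseChange K).toAffine.Point)
        (ys : (m : ℕ) → (W.baseChange (ringClassField K ι m)).toAffine.Point) (ε : ℤ),
        ShimuraWalk.LabelsAt W N K ι y ys ε →
        ∀ (q : ℕ) [Fact q.Prime], q ∣ N → q ∉ S → 3 ∣ (W.baseChange ℚ_[q]).localTamagawaNumber ℤ_[q] →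
          ∃ n' : ℕ, ¬ 3 ∣ n' ∧ ∀ m : ℕ, Squarefree m →
            (∀ r ∈ m.primeFactors, ¬ r ∣ N ∧ (Ideal.span {(r : 𝓞 K)}).IsPrime) →
            ∀ [NumberField (ringClassField K ι m)] (w : HeightOneSpectrum (𝓞 (ringClassField K ι m))),
              ((q : ℕ) : 𝓞 (ringClassField K ι m)) ∈ w.asIdeal →
              (placeIntModel W (ringClassField K ι m) w).HasNonsingularReduction (K := ringClassField K ι m) (n' • ys m) := by
  intro W _ _ N _ K _ _ S hsurj hK hD hsp ι y ys ε hL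
  haveI : ∀ j : ℕ, NumberField (ringClassField K ι j) := numberField_ringClassField K hK ι
  exact ShimuraWalk.carrierLabelsE0Prime_of_galTrivial_of_kills_of_auxLevel W ι hK (p := 3)
    (fun q _ hqN hqS h3 ↦ (CarrierLocalE0.stub_carrierLocalE0AtThree W K ι hK q h3 (hsp q Fact.out hqN hqS)).1)
    (fun q _ hqN hqS h3 ↦ (CarrierLocalE0.stub_carrierLocalE0AtThree W K ι hK q h3 (hsp q Fact.out hqN hqS)).2)
    (fun q _ hqN hqS _ ↦ AuxInertLevel.stub_auxiliaryInertLevelAtThree W K ι hK hD hsurj q N (hsp q Fact.out hqN hqS)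
      (NeZero.ne N)) ys hL

/-- **Crux 19109 `EulerHalvesAtThree` BY NAME — the r21 items-closer** (see the module docstring for the ledger of inputs). The chain is the
registered line's: McCallum Cor. 5.6 upper half (`…_of_casselsTate_of_frobeniusCongruence_of_E0`), Jetchev's MAX walk at `3 ∥ N`
(`Koly.jetchevMaxHLAtThree_of_swapLiterature`), the inert ORDER display (`Koly.inertDisplayAtThree_of_primitivesAtThreeInert_of_casselsTateLevelInputs`),
the inert SAVED display on the E′-label road (`ShimuraWalk.inertSavingDisplayAtThreeD_of_primitives_of_E0Prime_of_milne_of_poitouTate_of_casselsTate`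
at `Φ := Surj · 3` over `e0PrimeSupplyAtThree`), TL₃ from crux 19064 read at `3` (`Koly.twistLowerAtThree_of_thmC_of_x11aLowerHalfAtThree`), and
tam3-p1 g17's r16 composition `classRecordThree_eulerHalvesAtThree_of_jetchevMaxHL_of_displaysD_of_notRamServableDF_of_coStepLResidualNormalForm_of_twistLower`.
CONDITIONAL on the five items and the three raw inputs; nothing booked.
[cite: McCallumLMS1991, §5 Cor. 5.6 (p. 310)] [cite: Jetchev2008, Thm. 1.4 (p. 812)] [cite: GrossLMS1991, Prop. 3.7 (2), §6]
[cite: PastenShimura2024, Prop. 5.1, §6.6] [cite: Skinner2016PacificMC, Thm. C (§1)] [cite: Harari2020, Thm. 17.13 (b)] -/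
theorem eulerHalvesAtThree_of_items_r21
    (h : Summit.BirchSwinnertonDyer.BirchSwinnertonDyer.Theses.ClassRecordThree.PublishedInputsThree)
    (hF : Summit.BirchSwinnertonDyer.BirchSwinnertonDyer.Theses.ClassRecordThree.EulerHalfGrossPrintFacts)
    (hSh : Summit.BirchSwinnertonDyer.BirchSwinnertonDyer.Theses.ClassRecordThree.ShimuraParametrizationDataNonempty)
    (hCO : Summit.BirchSwinnertonDyer.BirchSwinnertonDyer.Theses.ErratumRoadFive.PastenComponentOrdersInput)
    (hX : Summit.BirchSwinnertonDyer.BirchSwinnertonDyer.Theses.ErratumRoadFive.X11aLowerHalf)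
    -- raw (no `ClassRecordThree` ∕ `KolyvaginRoadThree` item yet):
    (hPT2 : ∀ (K : Type) [Field K] [NumberField K], poitouTate_sha_tateDual K)
    (hPrim : shimuraCurve_heegnerSystem_primitivesAtThreeInert)
    (hRes :
    ∀ (W : WeierstrassCurve ℚ) [W.IsElliptic] [W.IsGloballyMinimal],
      (∀ v : HeightOneSpectrum (𝓞 ℚ),
        padicValNat 3 (W.tamagawaNumberAt v) < padicValNat 3 W.tamagawaProduct) →
      ((∃ (q₀ : ℕ) (_ : Fact q₀.Prime), q₀ ≠ 3 ∧ 3 ∣ (W.baseChange ℚ_[q₀]).localTamagawaNumber ℤ_[q₀] ∧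
          ¬ W.HasSplitMultiplicativeReductionAtPrime q₀ ∧
          ∃ (q₀' : ℕ) (_ : Fact q₀'.Prime), q₀' ≠ 3 ∧ q₀' ≠ q₀ ∧
            3 ∣ (W.baseChange ℚ_[q₀']).localTamagawaNumber ℤ_[q₀'] ∧ ¬ W.HasSplitMultiplicativeReductionAtPrime q₀') ∨
       ∃ (q₁ : ℕ) (_ : Fact q₁.Prime), q₁ ≠ 3 ∧ 3 ∣ (W.baseChange ℚ_[q₁]).localTamagawaNumber ℤ_[q₁] ∧
        ¬ W.HasSplitMultiplicativeReductionAtPrime q₁ ∧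
        (∀ (q : ℕ) [Fact q.Prime], q ≠ 3 → q ≠ q₁ → 3 ∣ (W.baseChange ℚ_[q]).localTamagawaNumber ℤ_[q] →
          W.HasSplitMultiplicativeReductionAtPrime q) ∧
        (∀ (ℓ : ℕ) [Fact ℓ.Prime], ℓ ≠ 3 → Mult W ℓ →
          W.HasSplitMultiplicativeReductionAtPrime ℓ ∧ 3 ∣ padicValInt ℓ W.minimalDiscriminantInt) ∧
        ∃ B : Finset ℕ, (∀ q : ℕ, q ∈ B ↔ ∃ _ : Fact q.Prime, q ≠ 3 ∧ W.HasSplitMultiplicativeReductionAtPrime q ∧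
            3 ∣ padicValInt q W.minimalDiscriminantInt) ∧ Even B.card) →
      ∀ (N : ℕ) [NeZero N] (K : Type) [Field K] [NumberField K]
        (Dt : ModularParametrizationData W N) (H : HeegnerDatum N (NumberField.discr K)) (ι : K →+* ℂ)
        (P : (W.baseChange K).toAffine.Point),
        ClassX11b W 3 → Surj W 3 → W.conductorNorm ℤ = N → IsImaginaryQuadratic K →
        Odd (NumberField.discr K) → SatisfiesHeegnerHypothesis N K →
        (W.quadraticTwist (NumberField.discr K : ℚ)).entireLFunction 1 ≠ 0 →
        WeierstrassCurve.Affine.Point.map ι.toRatAlgHom P = heegnerPointComplex Dt H →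
        ¬ (3 : ℤ) ∣ Dt.c → ¬ IsOfFinAddOrder P →
        ∀ (κ : ZpExtension K 3), κ.IsAnticyclotomic →
          ∀ (γ : Field.absoluteGaloisGroup K) [Fact (κ.IsTopGenerator γ)]
            (𝔭 : HeightOneSpectrum (𝓞 K)) (h𝔭 : ((3 : ℕ) : 𝓞 K) ∈ 𝔭.asIdeal)
            (he : 𝔭.asIdeal.ramificationIdx (𝓞 ℚ) = 1) (hf : 𝔭.asIdeal.inertiaDeg (𝓞 ℚ) = 1),
            IMCUpperWaldspurgerOnTreeAt 3 κ 𝔭 γ (embAt K 3 𝔭 h𝔭 he hf) P) :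
    Summit.BirchSwinnertonDyer.BirchSwinnertonDyer.Theses.ClassRecordThree.EulerHalvesAtThree := by
  have hF1 : Gross1991_heegnerPoint_sub_ratTorsion_mem_E0 := Gross1991_heegnerPoint_sub_ratTorsion_mem_E0_of_imageFree hF.2
  -- the Cassels–Tate level inputs: cell bsd-wall's Ш²-cochain bridge (the proof term of item 20191's closer
  -- `ShaTwoCochainTheta.casselsTate_levelInputs_of_shaTwoCochainBridge`, restated over its three route-independent modules)
  have hCT : ∀ (K : Type) [Field K] [NumberField K], casselsTate_levelInputs K := fun K _ _ ↦
    ShaTwoCochainTheta.casselsTate_levelInputs_of_readout_vanishing_flip K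
      (ShaTwoCochainTheta.hbridge_of_readout_criterion K
        (ShaTwoCochain.classBarInv_readout_eq_zero_of_criterion K))
  have hPT : ∀ (K : Type) [Field K] [NumberField K], poitouTate_selmerStructure_duality_conj K :=
    poitouTate_conj_forall_of_selmerComplement_canonical fun K _ _ n _ ↦
      Summit.BirchSwinnertonDyer.BirchSwinnertonDyer.Theorems.SchneiderFreeAdditiveX3.PoitouTateReduction.selmerComplement_canonical_holds
        K n
  have hM38 : Milne2006_localTamagawaNumber_smul_unramifiedClass_eq_zero.{0} :=
    MilneTamagawa.Milne2006_localTamagawaNumber_smul_unramifiedClass_eq_zero_holds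
  have hX3 : ∀ (V : WeierstrassCurve ℚ) [V.IsElliptic] [V.IsGloballyMinimal],
      Summit.BirchSwinnertonDyer.Rank1Residual.ClassX11a V 3 →
        Literature.NumberTheory.EllipticCurves.Rank1Residual.Typed.MissingLowerBoundAt V 3 :=
    fun V _ _ hV ↦ hX V 3 hV
  obtain ⟨hGZ, hKo, -, hSk, -, hGZK, hmod, hnf, hHL, hMaz, -, hFH, hBR, -, -, -, -, -, -, -⟩ := h
  have hMcU : McCallum1991_padicValNat_card_sha_primary_add_le_of_globalDivisibility :=
    McCallum1991_padicValNat_card_sha_primary_add_le_of_globalDivisibility_of_casselsTate_of_frobeniusCongruence_of_E0 hCT hF.1 hF1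
  have hJ := jetchevMaxHLAtThree_of_swapLiterature hF.1 hGZ hmod hPT hF1
  have hDisp := inertDisplayAtThree_of_primitivesAtThreeInert_of_casselsTateLevelInputs hCT hPrim
  have hSav := ShimuraWalk.inertSavingDisplayAtThreeD_of_primitives_of_E0Prime_of_milne_of_poitouTate_of_casselsTate
    (fun V ↦ Surj V 3) (fun _ _ _ _ hsurj ↦ hsurj) hCT hPrim hM38 hPT e0PrimeSupplyAtThree
  have hTL := Summit.BirchSwinnertonDyer.Rank1Residual.X11b.Three.Koly.twistLowerAtThree_of_thmC_of_x11aLowerHalfAtThree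
    hmod hGZK hSk hX3
  exact classRecordThree_eulerHalvesAtThree_of_jetchevMaxHL_of_displaysD_of_notRamServableDF_of_coStepLResidualNormalForm_of_twistLower
    hGZ hKo hSk hGZK hmod hnf hHL hMaz (fun N _ W K _ _ ↦ heegnerPointOfConductor_one_galoisConj_holds N W K)
    (fun N _ W K _ _ ↦ phi_heegnerTau_mem_singularModuliField_holds N W K) hMcU
    (fun K _ _ ↦ poitouTate_selmerStructure_duality_of_conj (hPT K)) hPT2 hFH hBR
    hSh hCO hJ hDisp hTL hSav hX3 hRes

/-- **The `KolyvaginRoadThree` twin** (same statement; binders = KR3's own items 27981 ∕ 19524, shared by id, CR3's 19112 as in r10–r20, and the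
two `ErratumRoadFive` items). [cite: McCallumLMS1991, §5 Cor. 5.6 (p. 310)] [cite: Jetchev2008, Thm. 1.4 (p. 812)] -/
theorem kolyvaginRoadThree_eulerHalvesAtThree_of_items_r21
    (h : Summit.BirchSwinnertonDyer.BirchSwinnertonDyer.Theses.ClassRecordThree.PublishedInputsThree)
    (hF : Summit.BirchSwinnertonDyer.BirchSwinnertonDyer.Theses.KolyvaginRoadThree.EulerHalfGrossPrintFacts)
    (hSh : Summit.BirchSwinnertonDyer.BirchSwinnertonDyer.Theses.KolyvaginRoadThree.ShimuraParametrizationDataNonempty)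
    (hCO : Summit.BirchSwinnertonDyer.BirchSwinnertonDyer.Theses.ErratumRoadFive.PastenComponentOrdersInput)
    (hX : Summit.BirchSwinnertonDyer.BirchSwinnertonDyer.Theses.ErratumRoadFive.X11aLowerHalf)
    (hPT2 : ∀ (K : Type) [Field K] [NumberField K], poitouTate_sha_tateDual K)
    (hPrim : shimuraCurve_heegnerSystem_primitivesAtThreeInert)
    (hRes :
    ∀ (W : WeierstrassCurve ℚ) [W.IsElliptic] [W.IsGloballyMinimal],
      (∀ v : HeightOneSpectrum (𝓞 ℚ),
        padicValNat 3 (W.tamagawaNumberAt v) < padicValNat 3 W.tamagawaProduct) →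
      ((∃ (q₀ : ℕ) (_ : Fact q₀.Prime), q₀ ≠ 3 ∧ 3 ∣ (W.baseChange ℚ_[q₀]).localTamagawaNumber ℤ_[q₀] ∧
          ¬ W.HasSplitMultiplicativeReductionAtPrime q₀ ∧
          ∃ (q₀' : ℕ) (_ : Fact q₀'.Prime), q₀' ≠ 3 ∧ q₀' ≠ q₀ ∧
            3 ∣ (W.baseChange ℚ_[q₀']).localTamagawaNumber ℤ_[q₀'] ∧ ¬ W.HasSplitMultiplicativeReductionAtPrime q₀') ∨
       ∃ (q₁ : ℕ) (_ : Fact q₁.Prime), q₁ ≠ 3 ∧ 3 ∣ (W.baseChange ℚ_[q₁]).localTamagawaNumber ℤ_[q₁] ∧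
        ¬ W.HasSplitMultiplicativeReductionAtPrime q₁ ∧
        (∀ (q : ℕ) [Fact q.Prime], q ≠ 3 → q ≠ q₁ → 3 ∣ (W.baseChange ℚ_[q]).localTamagawaNumber ℤ_[q] →
          W.HasSplitMultiplicativeReductionAtPrime q) ∧
        (∀ (ℓ : ℕ) [Fact ℓ.Prime], ℓ ≠ 3 → Mult W ℓ →
          W.HasSplitMultiplicativeReductionAtPrime ℓ ∧ 3 ∣ padicValInt ℓ W.minimalDiscriminantInt) ∧
        ∃ B : Finset ℕ, (∀ q : ℕ, q ∈ B ↔ ∃ _ : Fact q.Prime, q ≠ 3 ∧ W.HasSplitMultiplicativeReductionAtPrime q ∧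
            3 ∣ padicValInt q W.minimalDiscriminantInt) ∧ Even B.card) →
      ∀ (N : ℕ) [NeZero N] (K : Type) [Field K] [NumberField K]
        (Dt : ModularParametrizationData W N) (H : HeegnerDatum N (NumberField.discr K)) (ι : K →+* ℂ)
        (P : (W.baseChange K).toAffine.Point),
        ClassX11b W 3 → Surj W 3 → W.conductorNorm ℤ = N → IsImaginaryQuadratic K →
        Odd (NumberField.discr K) → SatisfiesHeegnerHypothesis N K →
        (W.quadraticTwist (NumberField.discr K : ℚ)).entireLFunction 1 ≠ 0 →
        WeierstrassCurve.Affine.Point.map ι.toRatAlgHom P = heegnerPointComplex Dt H →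
        ¬ (3 : ℤ) ∣ Dt.c → ¬ IsOfFinAddOrder P →
        ∀ (κ : ZpExtension K 3), κ.IsAnticyclotomic →
          ∀ (γ : Field.absoluteGaloisGroup K) [Fact (κ.IsTopGenerator γ)]
            (𝔭 : HeightOneSpectrum (𝓞 K)) (h𝔭 : ((3 : ℕ) : 𝓞 K) ∈ 𝔭.asIdeal)
            (he : 𝔭.asIdeal.ramificationIdx (𝓞 ℚ) = 1) (hf : 𝔭.asIdeal.inertiaDeg (𝓞 ℚ) = 1),
            IMCUpperWaldspurgerOnTreeAt 3 κ 𝔭 γ (embAt K 3 𝔭 h𝔭 he hf) P) :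
    Summit.BirchSwinnertonDyer.BirchSwinnertonDyer.Theses.KolyvaginRoadThree.EulerHalvesAtThree :=
  eulerHalvesAtThree_of_items_r21 h hF hSh hCO hX hPT2 hPrim hRes

end Summit.BirchSwinnertonDyer.BirchSwinnertonDyer.Theorems.EulerHalvesInertR21

end
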